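import Literature.IUT.HodgeArakelov.MonoThetaFromGroupsProp13Genuine
import Literature.IUT.HodgeArakelov.ModelDef11OutputOfOrigin
import Literature.AnabelianGeometry.EtaleTheta.Discharge.Sec1CompatHolds

/-!
# [IUTchII] §1 cone closers (Prop. 1.2, 1.3) with their PROVED [EtTh] FACT-LIST inputs supplied by name

abc-iut cell, sub-cell L-K/R-C (D-0079), seat abc-iut-L6-t5 gen 12, row «K-READY-L6» — file 1 of 2. Source of the
row: the L6 lines of abc-iut-c312-2 gen 5's `CONE-K-READY.tsv` (K-census v4, 2026-08-26T15:06Z) = binder sites in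
cone CLOSING theorems whose FACT-LIST row is already PROVED in the tree, so that the binder can be discharged by
applying the row's witness ("mechanical K-moves"). This file covers the 12 sites whose closers live in
`MonoThetaFromGroupsProp13Genuine.lean`, `MonoThetaFromGroupsProofsTate.lean`, `ModelCyclotomesZHat.lean` and
`ModelDef11OutputOfOrigin.lean`:

* **F-0539** `ThetaFrobenioid.OuterActionLZ` ([EtTh] Lem. 5.9 (iii), p.332 (PDF p.106): `Π^tp_X̲` normalises `E_N`
  through `s^⊓-gp_N ∘ ρ`) — binder `h3`, 7 sites, cone nodes `IUTchII:Prop1.2(ii)` (`envOfBiTheta_toEtale`) and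
  `IUTchII:Prop1.3(i)` (`mem_ofBiTheta_extCyc_iff`, `ofBiTheta_extCyc_eq_ker_toPiY`, `ofBiTheta_extCyc_eq_range_muIncl`,
  `muIncl_corrExtOfBiTheta`, `prop13_i_ii_ofBiTheta`, `ofEnvIsoBiTheta_extCyc_eq_ker_toPiY`); witness
  `ThetaFrobenioid.outerActionLZ_of` (abc-iut-L2 lineage w5-d231, `FrobenioidMonoTheta.lean`), a theorem for EVERY
  theta Frobenioid `𝔉`.
* **F-2491** `ThetaSetting.Compat` ([EtTh] §1 p.22: the containments `Δ_Θ ⊆ (Δ^tp_Y)^Θ`, `Δ_Θ ⊆ (Δ^tp_Ÿ)^Θ`,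
  `K̈/K` Galois) — binder `hC`, 5 sites here, cone nodes `IUTchII:Prop1.2(i)`
  (`exists_envOfGroup_indeterminacy_ofDoubleUnderline_of_origin`, `nonempty_envOfGroup_ofDoubleUnderline_of_origin`,
  `prop12_i_indeterminacy_envOfGroup_ofDoubleUnderline_of_origin`) and `IUTchII:Prop1.2(ii)`
  (`exists_envOfFrobenioid_indeterminacy_ofDoubleUnderline`, `…_of_origin`); witness `ThetaSetting.compat`
  (abc-iut-L2 lineage w5-d017, `Discharge/Sec1CompatHolds.lean`), a theorem for EVERY `D : ThetaSetting p`.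
  The remaining 11 F-2491 sites (Prop. 1.5 / 2.1 / 2.2 closers) are file 2 (`EtThProvedInputsSuppliedLevels.lean`).

WHAT THIS FILE IS. PROOF-ONLY (no `def`, no Prop-valued fact, no `instance`, no `sorry`): for each site ONE sibling
`<closer>_outerActionSupplied` / `<closer>_compatSupplied` whose statement is the closer's SOURCE statement with the
one binder deleted and each of its occurrences (in later binder types and in the conclusion) replaced by the witness
term `𝔉.outerActionLZ_of` / `D.compat`; proof = the closer applied to the witness. Same `variable` telescopes as the
source sections. The closers themselves (typer / discharger lineages abc-iut-L6-t1, L6-d6, w4-d008, w4-d030, w5-d177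
and the [IUTchII] §1 model programme) are untouched; nothing printed is restated as a new statement.

WHAT IT MOVES AND WHAT IT DOES NOT (honest): the «proved» binder-pair class of the K census (these 12 + file 2's 11 =
23 of its 32 sites); the affected nodes are already NODES-discharged; `proved` rows are not assumption-class, so
K1/K3, `cone_discharged` and the C scoreboard are unchanged by this file; whether the kernel index re-points a node's
closer to a sibling here is abc-iut-c312-2's decision. Typed ≠ proved-as-printed; instantiated ≠ endorsed; no side
taken on [IUTchIII] Cor. 3.12; nothing here asserts that abc is proved or refuted.
[claim: Mochizuki2012, status: disputed] (statements); [cite: MochizukiEtTh2009, Lem 5.9 (iii) p.332 (PDF p.106)],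
[cite: MochizukiEtTh2009, Prop 1.5 p.22] (the two supplied inputs).
-/

namespace Literature.IUT.HodgeArakelov

universe w u

open CategoryTheory Literature.AnabelianGeometry.EtaleTheta
open scoped Literature.AnabelianGeometry.EtaleTheta

/-! ## Part A — F-0539 `OuterActionLZ` supplied (`𝔉.outerActionLZ_of`): the genuine `M^Θ(𝒞) = E^Π_N` closers -/

section BiTheta

variable {S : ThetaSetting.{u}} {l : ℕ} {R : RigidData.{u} S.N l}
variable {C : Type (u + 1)} [Category.{u} C] {D : Type (u + 1)} [Category.{u} D]
  (𝔉 : ThetaFrobenioid.{w} C D) (h1 : 𝔉.SectionsFactor)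
  (hsec : 𝔉.SgpCapSection) (hcs : 𝔉.SgpCupSection) (h8 : 𝔉.ConstantsEqNormalizer)
  (DK : Set (TopOut 𝔉.EPiN))

/-- K-move, node `IUTchII:Prop1.2(ii)`, site `envOfBiTheta_toEtale`/`h3` (F-0539 supplied by
`ThetaFrobenioid.outerActionLZ_of`): the underlying [EtTh] datum of `envOfBiTheta` is `E^Π_N` on the nose — with the
[EtTh] Lem. 5.9 (iii) input no longer a binder. [claim: Mochizuki2012, status: disputed] (IUTchII §1 Prop 1.2 (ii), kurims pp.25-26) -/
theorem envOfBiTheta_toEtale_outerActionSupplied (h218ii : R.toThetaEnvData.Cor218_ii)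
    (A : ModelAgreement S R.toThetaEnvData) {η : R.PiYdd → R.mu} (hη : η ∈ R.thetaCocycles)
    (i : (𝔉.frdBiThetaEnv h1 𝔉.outerActionLZ_of hsec hcs h8 DK).Iso (R.toThetaEnvData.modelBi hη)) :
    (envOfBiTheta 𝔉 h1 𝔉.outerActionLZ_of hsec hcs h8 DK h218ii A hη i).toEtale =
      𝔉.frdMonoThetaEnv h1 𝔉.outerActionLZ_of hsec hcs h8 DK :=
  envOfBiTheta_toEtale 𝔉 h1 𝔉.outerActionLZ_of hsec hcs h8 DK h218ii A hη i

/-- K-move, node `IUTchII:Prop1.3(i)`, site `mem_ofBiTheta_extCyc_iff`/`h3` (F-0539 supplied): membership form of the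
exterior clause `Π_μ(M^Θ(𝒞)) = Ker(E^Π_N ↠ Π^tp_Y̲)` at the genuine `M^Θ(𝒞)`.
[claim: Mochizuki2012, status: disputed] (IUTchII §1 Prop 1.3 (i), kurims p.26) -/
theorem mem_ofBiTheta_extCyc_iff_outerActionSupplied (h218ii : R.toThetaEnvData.Cor218_ii)
    (A : ModelAgreement S R.toThetaEnvData) {η : R.PiYdd → R.mu} (hη : η ∈ R.thetaCocycles)
    (i : (𝔉.frdBiThetaEnv h1 𝔉.outerActionLZ_of hsec hcs h8 DK).Iso (R.toThetaEnvData.modelBi hη))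
    (F : ModelFrame S R) (Fr : TemperedFrobenioidData S) (ι : 𝔉.PiX ≃ₜ* R.PiX)
    (hi : ∀ x : 𝔉.EPiN, ((CycEnvelope.proj R.augY R.chi (i.e x) : R.PiY) : R.PiX) = ι (𝔉.toPiY x))
    (x : 𝔉.EPiN) :
    x ∈ (EnvOfFrobenioid.ofBiTheta 𝔉 h1 𝔉.outerActionLZ_of hsec hcs h8 DK h218ii A hη i F Fr).recon.extCyc ↔
      𝔉.toPiY x = 1 :=
  mem_ofBiTheta_extCyc_iff 𝔉 h1 𝔉.outerActionLZ_of hsec hcs h8 DK h218ii A hη i F Fr ι hi x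

/-- K-move, node `IUTchII:Prop1.3(i)`, site `ofBiTheta_extCyc_eq_ker_toPiY`/`h3` (F-0539 supplied): the exterior
cyclotome of the genuine `M^Θ(𝒞)` IS `Ker(E^Π_N ↠ Π^tp_Y̲)`. [claim: Mochizuki2012, status: disputed] (IUTchII §1 Prop 1.3 (i), kurims p.26) -/
theorem ofBiTheta_extCyc_eq_ker_toPiY_outerActionSupplied (h218ii : R.toThetaEnvData.Cor218_ii)
    (A : ModelAgreement S R.toThetaEnvData) {η : R.PiYdd → R.mu} (hη : η ∈ R.thetaCocycles)
    (i : (𝔉.frdBiThetaEnv h1 𝔉.outerActionLZ_of hsec hcs h8 DK).Iso (R.toThetaEnvData.modelBi hη))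
    (F : ModelFrame S R) (Fr : TemperedFrobenioidData S) (ι : 𝔉.PiX ≃ₜ* R.PiX)
    (hi : ∀ x : 𝔉.EPiN, ((CycEnvelope.proj R.augY R.chi (i.e x) : R.PiY) : R.PiX) = ι (𝔉.toPiY x)) :
    (EnvOfFrobenioid.ofBiTheta 𝔉 h1 𝔉.outerActionLZ_of hsec hcs h8 DK h218ii A hη i F Fr).recon.extCyc =
      𝔉.toPiY.ker :=
  ofBiTheta_extCyc_eq_ker_toPiY 𝔉 h1 𝔉.outerActionLZ_of hsec hcs h8 DK h218ii A hη i F Fr ι hi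

/-- K-move, node `IUTchII:Prop1.3(i)`, site `ofBiTheta_extCyc_eq_range_muIncl`/`h3` (F-0539 supplied): the exterior
cyclotome of the genuine `M^Θ(𝒞)` IS the image of `μ_N(B_N) ↪ E^Π_N`.
[claim: Mochizuki2012, status: disputed] (IUTchII §1 Prop 1.3 (i), kurims p.26) -/
theorem ofBiTheta_extCyc_eq_range_muIncl_outerActionSupplied (h218ii : R.toThetaEnvData.Cor218_ii)
    (A : ModelAgreement S R.toThetaEnvData) {η : R.PiYdd → R.mu} (hη : η ∈ R.thetaCocycles)
    (i : (𝔉.frdBiThetaEnv h1 𝔉.outerActionLZ_of hsec hcs h8 DK).Iso (R.toThetaEnvData.modelBi hη))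
    (F : ModelFrame S R) (Fr : TemperedFrobenioidData S) (ι : 𝔉.PiX ≃ₜ* R.PiX)
    (hi : ∀ x : 𝔉.EPiN, ((CycEnvelope.proj R.augY R.chi (i.e x) : R.PiY) : R.PiX) = ι (𝔉.toPiY x)) :
    (EnvOfFrobenioid.ofBiTheta 𝔉 h1 𝔉.outerActionLZ_of hsec hcs h8 DK h218ii A hη i F Fr).recon.extCyc =
      𝔉.muIncl.range :=
  ofBiTheta_extCyc_eq_range_muIncl 𝔉 h1 𝔉.outerActionLZ_of hsec hcs h8 DK h218ii A hη i F Fr ι hi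

/-- K-move, node `IUTchII:Prop1.3(i)`, site `muIncl_corrExtOfBiTheta`/`h3` (F-0539 supplied): the canonical
exterior correspondence `Π_μ(M^Θ(𝒞)) ⥲ μ_N(B_N)` is the identity on underlying elements of `E^Π_N`.
[claim: Mochizuki2012, status: disputed] (IUTchII §1 Prop 1.3 (i), kurims p.26) -/
theorem muIncl_corrExtOfBiTheta_outerActionSupplied (h218ii : R.toThetaEnvData.Cor218_ii)
    (A : ModelAgreement S R.toThetaEnvData) {η : R.PiYdd → R.mu} (hη : η ∈ R.thetaCocycles)
    (i : (𝔉.frdBiThetaEnv h1 𝔉.outerActionLZ_of hsec hcs h8 DK).Iso (R.toThetaEnvData.modelBi hη))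
    (F : ModelFrame S R) (Fr : TemperedFrobenioidData S) (ι : 𝔉.PiX ≃ₜ* R.PiX)
    (hi : ∀ x : 𝔉.EPiN, ((CycEnvelope.proj R.augY R.chi (i.e x) : R.PiY) : R.PiX) = ι (𝔉.toPiY x))
    (x : (EnvOfFrobenioid.ofBiTheta 𝔉 h1 𝔉.outerActionLZ_of hsec hcs h8 DK h218ii A hη i F Fr).recon.extCyc) :
    𝔉.muIncl (corrExtOfBiTheta 𝔉 h1 𝔉.outerActionLZ_of hsec hcs h8 DK h218ii A hη i F Fr ι hi x) = x.1 :=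
  muIncl_corrExtOfBiTheta 𝔉 h1 𝔉.outerActionLZ_of hsec hcs h8 DK h218ii A hη i F Fr ι hi x

/-- K-move, node `IUTchII:Prop1.3(i)`, site `prop13_i_ii_ofBiTheta`/`h3` (F-0539 supplied): [IUTchII]
Prop. 1.3 (i)–(ii) for the GENUINE `M^Θ(𝒞) = E^Π_N` over the Prop. 1.2 (ii) interface instance of the §5 data,
remaining inputs exactly as in the closer. [claim: Mochizuki2012, status: disputed] (IUTchII §1 Prop 1.3 (i)(ii), kurims p.26) -/
theorem prop13_i_ii_ofBiTheta_outerActionSupplied (h218ii : R.toThetaEnvData.Cor218_ii)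
    (A : ModelAgreement S R.toThetaEnvData) {η : R.PiYdd → R.mu} (hη : η ∈ R.thetaCocycles)
    (i : (𝔉.frdBiThetaEnv h1 𝔉.outerActionLZ_of hsec hcs h8 DK).Iso (R.toThetaEnvData.modelBi hη))
    (F : ModelFrame S R) (ι : 𝔉.PiX ≃ₜ* R.PiX)
    (hi : ∀ x : 𝔉.EPiN, ((CycEnvelope.proj R.augY R.chi (i.e x) : R.PiY) : R.PiX) = ι (𝔉.toPiY x))
    (e : D ≌ BTemp0 S.PiX) (Pj : FrobenioidCyclotomicRigidity.ThetaSubquotientProj 𝔉)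
    (ψ : ModPow (ModelCyclotomes.intCyc R).carrier (S.N : ℕ) ≃* 𝔉.lDeltaModN 𝔉.BN)
    {MTM Gc PX : Type u} [Group MTM] [Group Gc] [Group PX]
    (i₁ : Gc ≃* PX) (i₂ : MTM ≃* Gc) (c₁ : 𝔉.muTorsion 𝔉.BN 𝔉.N ≃* MTM)
    (c₂ : 𝔉.lDeltaModN 𝔉.BN ≃* PX) :
    Prop13_i_ii (EnvOfFrobenioid.ofBiTheta 𝔉 h1 𝔉.outerActionLZ_of hsec hcs h8 DK h218ii A hη i F
      (TemperedFrobenioidData.ofThetaFrobenioid S 𝔉 e)) :=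
  prop13_i_ii_ofBiTheta 𝔉 h1 𝔉.outerActionLZ_of hsec hcs h8 DK h218ii A hη i F ι hi e Pj ψ i₁ i₂ c₁ c₂

end BiTheta

section OfEnvIsoBiTheta

variable {C : Type (u + 1)} [Category.{u} C] {D : Type (u + 1)} [Category.{u} D]
  (𝔉 : ThetaFrobenioid.{w} C D) (h1 : 𝔉.SectionsFactor)
  (hsec : 𝔉.SgpCapSection) (hcs : 𝔉.SgpCupSection) (h8 : 𝔉.ConstantsEqNormalizer)
  (DK : Set (TopOut 𝔉.EPiN))
  {l : ℕ} {R : RigidData.{u} 𝔉.N l} [TopologicalSpace R.G] [IsTopologicalGroup R.G]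
  (X : ThetaSetting.SideData R.toThetaEnvData)
  (F : ModelFrame (ThetaSetting.ofThetaEnvData R.toThetaEnvData X) R)
  (h218ii : R.toThetaEnvData.Cor218_ii) (ι : 𝔉.PiX ≃ₜ* R.PiX)
  (h59iv : 𝔉.EnvIsoBiTheta h1 𝔉.outerActionLZ_of hsec hcs h8 DK R.toThetaEnvData ι)
  (Fr : TemperedFrobenioidData (ThetaSetting.ofThetaEnvData R.toThetaEnvData X))

/-- K-move, node `IUTchII:Prop1.3(i)`, site `ofEnvIsoBiTheta_extCyc_eq_ker_toPiY`/`h3` (F-0539 supplied): the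
exterior clause at the genuine `M^Θ(𝒞)` built from [EtTh] Lem. 5.9 (iv) BY NAME (`EnvIsoBiTheta`, now read at
`𝔉.outerActionLZ_of`). [claim: Mochizuki2012, status: disputed] (IUTchII §1 Prop 1.3 (i), kurims p.26) -/
theorem ofEnvIsoBiTheta_extCyc_eq_ker_toPiY_outerActionSupplied :
    (EnvOfFrobenioid.ofEnvIsoBiTheta 𝔉 h1 𝔉.outerActionLZ_of hsec hcs h8 DK X F h218ii ι h59iv Fr).recon.extCyc =
      𝔉.toPiY.ker :=
  ofEnvIsoBiTheta_extCyc_eq_ker_toPiY 𝔉 h1 𝔉.outerActionLZ_of hsec hcs h8 DK X F h218ii ι h59iv Fr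

end OfEnvIsoBiTheta

/-! ## Part B — F-2491 `Compat` supplied (`D.compat`): [IUTchII] Prop. 1.2 (i)/(ii) at the Tate curve -/

namespace ThetaSetting

section Tate

variable {p : ℕ} [Fact p.Prime] {D : Literature.AnabelianGeometry.EtaleTheta.ThetaSetting p}
  {E : D.EtaleThetaData} {l : ℕ} (C : E.DoubleUnderline l) {N : ℕ+} (μ : D.CyclotomeMod l N)
  (hS : D.Sec2Hyps)

/-- K-move, node `IUTchII:Prop1.2(i)`, site `exists_envOfGroup_indeterminacy_ofDoubleUnderline_of_origin`/`hC`
(F-2491 supplied by `ThetaSetting.compat`): the Prop. 1.2 (i) output with its isomorphism-indeterminacy clause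
EXISTS for every topological group `Π ≅ Π^tp_{X̲̲_K}`, `hZ`-free form, the [EtTh] §1 containments no longer a binder.
[claim: Mochizuki2012, status: disputed] (IUTchII §1 Prop 1.2 (i), kurims p.25) -/
theorem exists_envOfGroup_indeterminacy_ofDoubleUnderline_of_origin_compatSupplied
    (h15 : Literature.AnabelianGeometry.EtaleTheta.ThetaSetting.Prop15iii E D.compat) (L : C.CuspLabels)
    (hl : l.Prime) (hp2 : p ≠ 2) (hpl : p ≠ l) (hζ : ∃ ζ : D.K, IsPrimitiveRoot ζ (4 * l))
    {η : (C.thetaEnvData μ D.compat hS).PiYdd → MuN p N} (hη : η ∈ (C.thetaEnvData μ D.compat hS).thetaCocycles)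
    (hO : D.IsEtThOrigin)
    (hYcl : (D.DtpY.map D.toHat.toMonoidHom).topologicalClosure ≤
      D.DtpY.map D.toHat.toMonoidHom ⊔ (⁅⁅D.DeltaHat, D.DeltaHat⁆, D.DeltaHat⁆).topologicalClosure)
    (P : TopGroup.{0}) (hP : Nonempty (P ≃ₜ* (ofDoubleUnderline C μ D.compat hS hl hp2 hpl hζ hη).PiX)) :
    ∃ Env : EnvOfGroup (ofDoubleUnderline C μ D.compat hS hl hp2 hpl hζ hη) P,
      Prop12_i_indeterminacy Env.recon :=
  exists_envOfGroup_indeterminacy_ofDoubleUnderline_of_origin C μ D.compat hS h15 L hl hp2 hpl hζ hη hO hYcl P hP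

/-- K-move, node `IUTchII:Prop1.2(i)`, site `nonempty_envOfGroup_ofDoubleUnderline_of_origin`/`hC` (F-2491
supplied): existence of the Prop. 1.2 (i) output `Π ↦ M^Θ(Π)` at the Tate curve, `hZ`-free, the [EtTh] §1
containments no longer a binder. [claim: Mochizuki2012, status: disputed] (IUTchII §1 Prop 1.2 (i), kurims p.25) -/
theorem nonempty_envOfGroup_ofDoubleUnderline_of_origin_compatSupplied
    (h15 : Literature.AnabelianGeometry.EtaleTheta.ThetaSetting.Prop15iii E D.compat) (L : C.CuspLabels)
    (hl : l.Prime) (hp2 : p ≠ 2) (hpl : p ≠ l) (hζ : ∃ ζ : D.K, IsPrimitiveRoot ζ (4 * l))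
    {η : (C.thetaEnvData μ D.compat hS).PiYdd → MuN p N} (hη : η ∈ (C.thetaEnvData μ D.compat hS).thetaCocycles)
    (hO : D.IsEtThOrigin)
    (hYcl : (D.DtpY.map D.toHat.toMonoidHom).topologicalClosure ≤
      D.DtpY.map D.toHat.toMonoidHom ⊔ (⁅⁅D.DeltaHat, D.DeltaHat⁆, D.DeltaHat⁆).topologicalClosure)
    (P : TopGroup.{0}) (hP : Nonempty (P ≃ₜ* (ofDoubleUnderline C μ D.compat hS hl hp2 hpl hζ hη).PiX)) :
    Nonempty (EnvOfGroup (ofDoubleUnderline C μ D.compat hS hl hp2 hpl hζ hη) P) :=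
  nonempty_envOfGroup_ofDoubleUnderline_of_origin C μ D.compat hS h15 L hl hp2 hpl hζ hη hO hYcl P hP

/-- K-move, node `IUTchII:Prop1.2(i)`, site `prop12_i_indeterminacy_envOfGroup_ofDoubleUnderline_of_origin`/`hC`
(F-2491 supplied): the indeterminacy clause of the CHOSEN `M^Θ(Π)` at the Tate curve, `hZ`-free, the [EtTh] §1
containments no longer a binder. [claim: Mochizuki2012, status: disputed] (IUTchII §1 Prop 1.2 (i), kurims p.25) -/
theorem prop12_i_indeterminacy_envOfGroup_ofDoubleUnderline_of_origin_compatSupplied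
    (h15 : Literature.AnabelianGeometry.EtaleTheta.ThetaSetting.Prop15iii E D.compat) (L : C.CuspLabels)
    (hl : l.Prime) (hp2 : p ≠ 2) (hpl : p ≠ l) (hζ : ∃ ζ : D.K, IsPrimitiveRoot ζ (4 * l))
    {η : (C.thetaEnvData μ D.compat hS).PiYdd → MuN p N} (hη : η ∈ (C.thetaEnvData μ D.compat hS).thetaCocycles)
    (hO : D.IsEtThOrigin)
    (hYcl : (D.DtpY.map D.toHat.toMonoidHom).topologicalClosure ≤
      D.DtpY.map D.toHat.toMonoidHom ⊔ (⁅⁅D.DeltaHat, D.DeltaHat⁆, D.DeltaHat⁆).topologicalClosure)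
    (P : TopGroup.{0}) (hP : Nonempty (P ≃ₜ* (ofDoubleUnderline C μ D.compat hS hl hp2 hpl hζ hη).PiX)) :
    Prop12_i_indeterminacy
      (envOfGroup (C.rigidData μ D.compat hS h15 L) (SideData.ofDoubleUnderline C μ D.compat hS hl hp2 hpl hζ hη)
        (t1Space_Huu C) (isClosed_ker_aug_thetaEnvData C μ D.compat hS)
        (ModelCyclotomes.nonempty_lDeltaQuot_rigidData_mulEquiv_zHat C μ D.compat hS h15 L hO hYcl hl.ne_zero)
        P hP).recon :=
  prop12_i_indeterminacy_envOfGroup_ofDoubleUnderline_of_origin C μ D.compat hS h15 L hl hp2 hpl hζ hη hO hYcl P hP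

/-- K-move, node `IUTchII:Prop1.2(ii)`, site `exists_envOfFrobenioid_indeterminacy_ofDoubleUnderline`/`hC` (F-2491
supplied): [IUTchII] Prop. 1.2 (ii) at the Tate curve (form with the cyclotome identification `hZ` a hypothesis),
the [EtTh] §1 containments no longer a binder. [claim: Mochizuki2012, status: disputed] (IUTchII §1 Prop 1.2 (ii), kurims pp.25-26) -/
theorem exists_envOfFrobenioid_indeterminacy_ofDoubleUnderline_compatSupplied
    (h15 : Literature.AnabelianGeometry.EtaleTheta.ThetaSetting.Prop15iii E D.compat) (L : C.CuspLabels)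
    (hl : l.Prime) (hp2 : p ≠ 2) (hpl : p ≠ l) (hζ : ∃ ζ : D.K, IsPrimitiveRoot ζ (4 * l))
    {η : (C.thetaEnvData μ D.compat hS).PiYdd → MuN p N} (hη : η ∈ (C.thetaEnvData μ D.compat hS).thetaCocycles)
    (hZ : Nonempty (ModelCyclotomes.lDeltaQuot (C.rigidData μ D.compat hS h15 L) ≃*
      Literature.IUT.HodgeTheaters.ZHat))
    (hO : D.IsEtThOrigin)
    (hYcl : (D.DtpY.map D.toHat.toMonoidHom).topologicalClosure ≤
      D.DtpY.map D.toHat.toMonoidHom ⊔ (⁅⁅D.DeltaHat, D.DeltaHat⁆, D.DeltaHat⁆).topologicalClosure)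
    (Fr : TemperedFrobenioidData (ofDoubleUnderline C μ D.compat hS hl hp2 hpl hζ hη))
    (M : MonoThetaEnv (ofDoubleUnderline C μ D.compat hS hl hp2 hpl hζ hη)) :
    ∃ Env : EnvOfFrobenioid Fr, Env.env = M ∧ Prop12_i_indeterminacy Env.recon :=
  exists_envOfFrobenioid_indeterminacy_ofDoubleUnderline C μ D.compat hS h15 L hl hp2 hpl hζ hη hZ hO hYcl Fr M

/-- K-move, node `IUTchII:Prop1.2(ii)`, site `exists_envOfFrobenioid_indeterminacy_ofDoubleUnderline_of_origin`/`hC`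
(F-2491 supplied): [IUTchII] Prop. 1.2 (ii) at the Tate curve, `hZ`-free, the [EtTh] §1 containments no longer a
binder. [claim: Mochizuki2012, status: disputed] (IUTchII §1 Prop 1.2 (ii), kurims pp.25-26) -/
theorem exists_envOfFrobenioid_indeterminacy_ofDoubleUnderline_of_origin_compatSupplied
    (h15 : Literature.AnabelianGeometry.EtaleTheta.ThetaSetting.Prop15iii E D.compat) (L : C.CuspLabels)
    (hl : l.Prime) (hp2 : p ≠ 2) (hpl : p ≠ l) (hζ : ∃ ζ : D.K, IsPrimitiveRoot ζ (4 * l))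
    {η : (C.thetaEnvData μ D.compat hS).PiYdd → MuN p N} (hη : η ∈ (C.thetaEnvData μ D.compat hS).thetaCocycles)
    (hO : D.IsEtThOrigin)
    (hYcl : (D.DtpY.map D.toHat.toMonoidHom).topologicalClosure ≤
      D.DtpY.map D.toHat.toMonoidHom ⊔ (⁅⁅D.DeltaHat, D.DeltaHat⁆, D.DeltaHat⁆).topologicalClosure)
    (Fr : TemperedFrobenioidData (ofDoubleUnderline C μ D.compat hS hl hp2 hpl hζ hη))
    (M : MonoThetaEnv (ofDoubleUnderline C μ D.compat hS hl hp2 hpl hζ hη)) :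
    ∃ Env : EnvOfFrobenioid Fr, Env.env = M ∧ Prop12_i_indeterminacy Env.recon :=
  exists_envOfFrobenioid_indeterminacy_ofDoubleUnderline_of_origin C μ D.compat hS h15 L hl hp2 hpl hζ hη hO hYcl
    Fr M

end Tate

end ThetaSetting

end Literature.IUT.HodgeArakelov
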